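import Literature.MathematicalPhysics.QuantumFieldTheory.UnitaryColumnLaw
import HarnessLib

/-!
# The transition map between the column-fibration coordinates and the Cayley chart of `U(N+1)`

Third step of the proof (by induction on `N`, without Weyl's integration formula) of the value of
the Haar small-ball constant of `U(N)` (S. Chatterjee, *The leading term of the Yang–Mills free
energy*, J. Funct. Anal. 271 (2016), arXiv:1602.01222, Thm. 6.1; constant
`UnitaryCayley.haarChartConst` of `UnitaryCayleyChart`, value in `UnitaryHaarVolume`). Everything
is proved; no definition of `Prop` type (named fact) is introduced.

For `a ∈ ℝ^{(N+1)²}` (`𝔼 (N+1)`, the parameter space of the Cayley chart, `X = skewOf a`) put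
`t(a) = a₀₀`, `w(a)_j = X_{j+1,0} ∈ ℂ`, `a' = (a_{j+1,k+1})` and
`Φ(a) = ichart (R(w(a)) · diag(chart a', e^{i t(a)}))` (`Phi`; `R`, `diag` from
`UnitaryColumnFibration`, `mk` from `UnitaryColumnLaw`). The point of these coordinates is the
identity `Ṙ(w(a)) + diag(skewOf a', i t(a)) = skewOf a` (`drot_add_dB`): **the derivative of the
transition map `Φ` at `0` is the identity**, so no Jacobian determinant ever has to be computed.
We prove this in the quantitative form consumed by Mathlib's volume-distortion lemmas
(`MeasureTheory.addHaar_image_le_mul_of_det_lt`, `mul_le_addHaar_image_of_lt_det`):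

* `approximatesLinearOn_Phi` — for every `c > 0` there is `r > 0` with
  `ApproximatesLinearOn Φ id (closedBall 0 r) c`, from the second-order ("strict
  differentiability") estimate `norm_Phi_sub_Phi_sub_le`:
  `‖Φ(a) - Φ(b) - (a - b)‖ ≤ 48 (N+1)³ (‖a‖ + ‖b‖) ‖a - b‖` for `‖a‖, ‖b‖ ≤ r_N = 1/(80 (N+1)³)`.
* The estimate is assembled from elementary ones, all with explicit constants and proved by
  matrix algebra in the Frobenius norm: `norm_cay_sub_cay_sub_le` (Cayley transform at `0`),
  `norm_icay_sub_icay_sub_le` (its inverse at `1`), `norm_exp_sub_exp_sub_le` (`t ↦ e^{it}`),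
  `norm_rot_sub_rot_sub_drot_le` (the rotation `R(w)` at `0`, derivative `drot`), the product rule
  `remainder_norm_le`, and `norm_Psi_sub_Psi_sub_le` for the matrix-valued parametrisation `Ψ`.
* `chart_Phi`: `chart (Φ a) = mk (t a) (w a) (chart a')` for `‖a‖ ≤ r_N`.

## References

* S. Chatterjee, *The leading term of the Yang–Mills free energy*, J. Funct. Anal. 271 (2016)
  2944–3005, arXiv:1602.01222, §6 (Thm. 6.1), §11 (the exponential chart; here replaced by the
  Cayley chart), §16 (Lemma 16.1, second-order agreement of the charts). [arXiv160201222]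
-/

noncomputable section

open scoped Matrix.Norms.Frobenius
open MeasureTheory Measure Set Filter Topology Complex Matrix
open scoped ENNReal NNReal Real

namespace Literature.MathematicalPhysics.QuantumFieldTheory

namespace UnitaryColumn

open UnitaryCayley
open Literature.Probability.RandomMatrix (nsq nsq_nonneg nsq_eq_zero_iff)

variable {N : ℕ}

/-! ### Frobenius-norm bookkeeping -/

section Frobenius

variable {m : Type*} [Fintype m]

/-- `‖A‖² = Σ ‖A i k‖²` (Frobenius). [folklore] -/
theorem frob_sq (A : Matrix m m ℂ) : ‖A‖ ^ 2 = ∑ i, ∑ k, ‖A i k‖ ^ 2 := by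
  rw [Matrix.frobenius_norm_def, ← Real.sqrt_eq_rpow,
    Real.sq_sqrt (Finset.sum_nonneg fun i _ => Finset.sum_nonneg fun j _ => by positivity)]
  simp

/-- Entries are bounded by the Frobenius norm. [folklore] -/
theorem norm_apply_le_frob (A : Matrix m m ℂ) (i k : m) : ‖A i k‖ ≤ ‖A‖ := by
  have h : ‖A i k‖ ^ 2 ≤ ‖A‖ ^ 2 := by
    rw [frob_sq A]
    exact (Finset.single_le_sum (f := fun k => ‖A i k‖ ^ 2) (fun _ _ => sq_nonneg _) (Finset.mem_univ k)).trans
      (Finset.single_le_sum (f := fun l => ∑ k, ‖A l k‖ ^ 2) (fun _ _ => Finset.sum_nonneg fun _ _ => sq_nonneg _)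
        (Finset.mem_univ i))
  exact le_of_sq_le_sq (by simpa using h) (norm_nonneg _)

/-- The Frobenius norm is bounded by the sum of the entries' norms. [folklore] -/
theorem frob_le_sum (A : Matrix m m ℂ) : ‖A‖ ≤ ∑ i, ∑ k, ‖A i k‖ := by
  refine le_of_sq_le_sq ?_ (Finset.sum_nonneg fun i _ => Finset.sum_nonneg fun k _ => norm_nonneg _)
  rw [frob_sq A]
  calc ∑ i, ∑ k, ‖A i k‖ ^ 2 ≤ ∑ i, (∑ k, ‖A i k‖) ^ 2 :=
        Finset.sum_le_sum fun i _ => Finset.sum_sq_le_sq_sum_of_nonneg fun k _ => norm_nonneg _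
    _ ≤ (∑ i, ∑ k, ‖A i k‖) ^ 2 :=
        Finset.sum_sq_le_sq_sum_of_nonneg fun i _ => Finset.sum_nonneg fun k _ => norm_nonneg _

end Frobenius

/-! ### Second-order estimates ("strict differentiability at a point") -/

section Cay

variable {n : ℕ}
local notation "𝕄n" => Matrix (Fin n) (Fin n) ℂ

/-- **Strict differentiability of the Cayley transform at `0`** (with derivative the identity):
`‖cay X - cay Y - (X - Y)‖ ≤ (‖X‖ + ‖Y‖) ‖X - Y‖` for skew-Hermitian `X, Y` with `‖Y‖ ≤ 2`. [folklore] -/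
theorem norm_cay_sub_cay_sub_le {X Y : 𝕄n} (hX : Xᴴ = -X) (hY : Yᴴ = -Y) (hY2 : ‖Y‖ ≤ 2) :
    ‖cay X - cay Y - (X - Y)‖ ≤ (‖X‖ + ‖Y‖) * ‖X - Y‖ := by
  have huX := (isUnit_iff_isUnit_det _).1 (isUnit_two_sub hX)
  have huY := (isUnit_iff_isUnit_det _).1 (isUnit_two_sub hY)
  set A := (2 - X)⁻¹ with hA
  set B := (2 - Y)⁻¹ with hB
  set D := X - Y with hD
  have hA2 : (2 : ℂ) • A = 1 + A * X := by
    have h : A * (2 - X) = 1 := Matrix.nonsing_inv_mul _ huX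
    rw [Matrix.mul_sub, mul_two] at h
    rw [two_smul]
    exact sub_eq_iff_eq_add.1 h
  have hB2 : (2 : ℂ) • B = 1 + Y * B := by
    have h : (2 - Y) * B = 1 := Matrix.mul_nonsing_inv _ huY
    rw [Matrix.sub_mul, two_mul] at h
    rw [two_smul]
    exact sub_eq_iff_eq_add.1 h
  have key : cay X - cay Y - D = A * X * D + D * Y * B + A * X * D * Y * B := by
    rw [cay_sub_cay hX hY, ← hA, ← hB, ← hD]
    have e : (4 : ℂ) • (A * D * B) = ((2 : ℂ) • A) * D * ((2 : ℂ) • B) := by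
      rw [Matrix.smul_mul, Matrix.smul_mul, Matrix.mul_smul, smul_smul]; norm_num
    rw [e, hA2, hB2]
    noncomm_ring
  -- norm bounds `‖A Z‖ ≤ ‖Z‖/2`, `‖Z B‖ ≤ ‖Z‖/2`
  have h1 : ∀ Z : 𝕄n, ‖A * Z‖ ≤ ‖Z‖ / 2 := fun Z => by
    have h := two_mul_norm_le_norm_two_sub_mul hX (A * Z)
    rw [← Matrix.mul_assoc, hA, Matrix.mul_nonsing_inv _ huX, Matrix.one_mul] at h
    linarith
  have h2 : ∀ Z : 𝕄n, ‖Z * B‖ ≤ ‖Z‖ / 2 := fun Z => by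
    have h := two_mul_norm_le_norm_mul_two_sub hY (Z * B)
    rw [Matrix.mul_assoc, hB, Matrix.nonsing_inv_mul _ huY, Matrix.mul_one] at h
    linarith
  have t1 : ‖A * X * D‖ ≤ ‖X‖ * ‖D‖ / 2 := by
    rw [Matrix.mul_assoc]
    exact (h1 _).trans (by gcongr; exact Matrix.frobenius_norm_mul _ _)
  have t2 : ‖D * Y * B‖ ≤ ‖D‖ * ‖Y‖ / 2 :=
    (h2 _).trans (by gcongr; exact Matrix.frobenius_norm_mul _ _)
  have t3 : ‖A * X * D * Y * B‖ ≤ ‖X‖ * ‖D‖ * ‖Y‖ / 4 := by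
    calc ‖A * X * D * Y * B‖ ≤ ‖A * X * D * Y‖ / 2 := h2 _
      _ ≤ ‖A * X * D‖ * ‖Y‖ / 2 := by gcongr; exact Matrix.frobenius_norm_mul _ _
      _ ≤ (‖X‖ * ‖D‖ / 2) * ‖Y‖ / 2 := by gcongr
      _ = ‖X‖ * ‖D‖ * ‖Y‖ / 4 := by ring
  rw [key]
  calc ‖A * X * D + D * Y * B + A * X * D * Y * B‖
      ≤ ‖A * X * D‖ + ‖D * Y * B‖ + ‖A * X * D * Y * B‖ := norm_add₃_le
    _ ≤ ‖X‖ * ‖D‖ / 2 + ‖D‖ * ‖Y‖ / 2 + ‖X‖ * ‖D‖ * ‖Y‖ / 4 := by linarith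
    _ ≤ (‖X‖ + ‖Y‖) * ‖D‖ := by
        have hXD : 0 ≤ ‖X‖ * ‖D‖ := mul_nonneg (norm_nonneg X) (norm_nonneg D)
        have h4 : ‖X‖ * ‖D‖ * ‖Y‖ ≤ ‖X‖ * ‖D‖ * 2 := mul_le_mul_of_nonneg_left hY2 hXD
        nlinarith [norm_nonneg Y, norm_nonneg D]

/-- **Strict differentiability of the inverse Cayley transform at `1`** (derivative the identity):
`‖icay U - icay V - (U - V)‖ ≤ 2 (‖U - 1‖ + ‖V - 1‖) ‖U - V‖` for `‖U - 1‖, ‖V - 1‖ ≤ 1`. [folklore] -/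
theorem norm_icay_sub_icay_sub_le {U V : 𝕄n} (hU : ‖U - 1‖ ≤ 1) (hV : ‖V - 1‖ ≤ 1) :
    ‖icay U - icay V - (U - V)‖ ≤ 2 * (‖U - 1‖ + ‖V - 1‖) * ‖U - V‖ := by
  have huU := (isUnit_iff_isUnit_det _).1 (isUnit_add_one (by linarith : ‖U - 1‖ < 2))
  have huV := (isUnit_iff_isUnit_det _).1 (isUnit_add_one (by linarith : ‖V - 1‖ < 2))
  set A := (U + 1)⁻¹ with hA
  set B := (V + 1)⁻¹ with hB
  set D := U - V with hD
  have hA2 : (2 : ℂ) • A = 1 - A * (U - 1) := by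
    have h : A * (U + 1) = 1 := Matrix.nonsing_inv_mul _ huU
    have e : (2 : ℂ) • A = A * (U + 1) + A * (1 - U) := by
      rw [← Matrix.mul_add, show U + 1 + (1 - U) = (2 : ℂ) • (1 : 𝕄n) by
        rw [two_smul]; abel, Matrix.mul_smul, Matrix.mul_one]
    rw [e, h, Matrix.mul_sub, Matrix.mul_sub, Matrix.mul_one]
    abel
  have hB2 : (2 : ℂ) • B = 1 - (V - 1) * B := by
    have h : (V + 1) * B = 1 := Matrix.mul_nonsing_inv _ huV
    have e : (2 : ℂ) • B = (V + 1) * B + (1 - V) * B := by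
      rw [← Matrix.add_mul, show V + 1 + (1 - V) = (2 : ℂ) • (1 : 𝕄n) by
        rw [two_smul]; abel, Matrix.smul_mul, Matrix.one_mul]
    rw [e, h, Matrix.sub_mul, Matrix.sub_mul, Matrix.one_mul]
    abel
  have hdiff : icay U - icay V = (4 : ℂ) • (A * D * B) := by
    have e1 : (U - 1) * A = A * (U - 1) := sub_one_mul_inv_comm huU
    rw [icay, icay, ← hA, ← hB, e1, ← smul_sub]
    have f1 : A * (U - 1) = A * (U - 1) * (V + 1) * B := by
      rw [Matrix.mul_assoc (A * (U - 1)) (V + 1) B, hB, Matrix.mul_nonsing_inv _ huV, Matrix.mul_one]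
    have f2 : (V - 1) * B = A * (U + 1) * (V - 1) * B := by
      rw [hA, Matrix.nonsing_inv_mul _ huU, Matrix.one_mul]
    have e2 : A * (U - 1) - (V - 1) * B = A * ((U - 1) * (V + 1) - (U + 1) * (V - 1)) * B := by
      rw [f1, f2]; noncomm_ring
    have e3 : (U - 1) * (V + 1) - (U + 1) * (V - 1) = (2 : ℂ) • D := by
      rw [hD, two_smul]; noncomm_ring
    rw [e2, e3, Matrix.mul_smul, Matrix.smul_mul, smul_smul]
    norm_num
  have key : icay U - icay V - D = -(A * (U - 1) * D) - D * (V - 1) * B + A * (U - 1) * D * (V - 1) * B := by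
    rw [hdiff]
    have e : (4 : ℂ) • (A * D * B) = ((2 : ℂ) • A) * D * ((2 : ℂ) • B) := by
      rw [Matrix.smul_mul, Matrix.smul_mul, Matrix.mul_smul, smul_smul]; norm_num
    rw [e, hA2, hB2]
    noncomm_ring
  have h1 : ∀ Z : 𝕄n, ‖A * Z‖ ≤ ‖Z‖ := fun Z => by
    have h := norm_add_one_mul_ge U (A * Z)
    rw [← Matrix.mul_assoc, hA, Matrix.mul_nonsing_inv _ huU, Matrix.one_mul] at h
    nlinarith [norm_nonneg (A * Z)]
  have h2 : ∀ Z : 𝕄n, ‖Z * B‖ ≤ ‖Z‖ := fun Z => by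
    have h := norm_mul_add_one_ge (Z * B) V
    rw [Matrix.mul_assoc, hB, Matrix.nonsing_inv_mul _ huV, Matrix.mul_one] at h
    nlinarith [norm_nonneg (Z * B)]
  have t1 : ‖A * (U - 1) * D‖ ≤ ‖U - 1‖ * ‖D‖ := by
    rw [Matrix.mul_assoc]
    exact (h1 _).trans (Matrix.frobenius_norm_mul _ _)
  have t2 : ‖D * (V - 1) * B‖ ≤ ‖D‖ * ‖V - 1‖ := (h2 _).trans (Matrix.frobenius_norm_mul _ _)
  have t3 : ‖A * (U - 1) * D * (V - 1) * B‖ ≤ ‖U - 1‖ * ‖D‖ * ‖V - 1‖ := by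
    calc ‖A * (U - 1) * D * (V - 1) * B‖ ≤ ‖A * (U - 1) * D * (V - 1)‖ := h2 _
      _ ≤ ‖A * (U - 1) * D‖ * ‖V - 1‖ := Matrix.frobenius_norm_mul _ _
      _ ≤ ‖U - 1‖ * ‖D‖ * ‖V - 1‖ := by gcongr
  rw [key]
  calc ‖-(A * (U - 1) * D) - D * (V - 1) * B + A * (U - 1) * D * (V - 1) * B‖
      ≤ ‖-(A * (U - 1) * D)‖ + ‖D * (V - 1) * B‖ + ‖A * (U - 1) * D * (V - 1) * B‖ :=
        (norm_add_le _ _).trans (add_le_add (norm_sub_le _ _) le_rfl)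
    _ ≤ ‖U - 1‖ * ‖D‖ + ‖D‖ * ‖V - 1‖ + ‖U - 1‖ * ‖D‖ * ‖V - 1‖ := by rw [norm_neg]; linarith
    _ ≤ 2 * (‖U - 1‖ + ‖V - 1‖) * ‖D‖ := by
        have hUD : 0 ≤ ‖U - 1‖ * ‖D‖ := mul_nonneg (norm_nonneg _) (norm_nonneg _)
        have h4 : ‖U - 1‖ * ‖D‖ * ‖V - 1‖ ≤ ‖U - 1‖ * ‖D‖ * 1 := mul_le_mul_of_nonneg_left hV hUD
        nlinarith [norm_nonneg (V - 1), norm_nonneg D]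

end Cay

/-- **Strict differentiability of `t ↦ e^{it}` at `0`**: `|e^{it} - e^{is} - i(t-s)| ≤ 2(|t|+|s|)|t-s|`
for `|t|, |s| ≤ 1/2`. [folklore] -/
theorem norm_exp_sub_exp_sub_le {t s : ℝ} (ht : |t| ≤ 1 / 2) (hs : |s| ≤ 1 / 2) :
    ‖Complex.exp (t * I) - Complex.exp (s * I) - ((t - s : ℝ) : ℂ) * I‖ ≤ 2 * (|t| + |s|) * |t - s| := by
  have hts : |t - s| ≤ 1 := (abs_sub _ _).trans (by linarith)
  have e : Complex.exp (t * I) - Complex.exp (s * I) - ((t - s : ℝ) : ℂ) * I =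
      Complex.exp (s * I) * (Complex.exp (((t - s : ℝ) : ℂ) * I) - 1 - ((t - s : ℝ) : ℂ) * I) +
        (Complex.exp (s * I) - 1) * (((t - s : ℝ) : ℂ) * I) := by
    rw [show Complex.exp (t * I) = Complex.exp (s * I) * Complex.exp (((t - s : ℝ) : ℂ) * I) by
      rw [← Complex.exp_add]; push_cast; ring_nf]
    ring
  have hz : ‖((t - s : ℝ) : ℂ) * I‖ = |t - s| := by
    rw [norm_mul, Complex.norm_I, mul_one, Complex.norm_real, Real.norm_eq_abs]
  have h1 : ‖Complex.exp (((t - s : ℝ) : ℂ) * I) - 1 - ((t - s : ℝ) : ℂ) * I‖ ≤ |t - s| ^ 2 := by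
    have h := Complex.norm_exp_sub_one_sub_id_le (x := ((t - s : ℝ) : ℂ) * I) (by rw [hz]; exact hts)
    rwa [hz] at h
  have h2 : ‖Complex.exp (s * I) - 1‖ ≤ |s| := by
    have h := Real.norm_exp_I_mul_ofReal_sub_one_le (x := s)
    rw [mul_comm] at h
    simpa using h
  have hes : ‖Complex.exp (s * I)‖ = 1 := Complex.norm_exp_ofReal_mul_I s
  rw [e]
  calc _ ≤ ‖Complex.exp (s * I) * (Complex.exp (((t - s : ℝ) : ℂ) * I) - 1 - ((t - s : ℝ) : ℂ) * I)‖ +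
        ‖(Complex.exp (s * I) - 1) * (((t - s : ℝ) : ℂ) * I)‖ := norm_add_le _ _
    _ ≤ |t - s| ^ 2 + |s| * |t - s| := by
        rw [norm_mul, norm_mul, hes, one_mul, hz]
        exact add_le_add h1 (mul_le_mul_of_nonneg_right h2 (abs_nonneg _))
    _ ≤ 2 * (|t| + |s|) * |t - s| := by
        have h3 : |t - s| ≤ |t| + |s| := abs_sub _ _
        have := abs_nonneg t; have := abs_nonneg s; have := abs_nonneg (t - s)
        nlinarith

/-! ### Second-order estimate for the rotation `R(w)` -/

section Rot

/-- The derivative `Ṙ(v) = [[0, v], [-v*, 0]]` of `w ↦ R(w)` at `w = 0`. [folklore] -/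
def drot (v : Fin N → ℂ) : Matrix (Idx N) (Idx N) ℂ :=
  Matrix.of fun i k =>
    match i, k with
    | Sum.inl _, Sum.inl _ => 0
    | Sum.inl j, Sum.inr _ => v j
    | Sum.inr _, Sum.inl k => -(starRingEnd ℂ) (v k)
    | Sum.inr _, Sum.inr _ => 0

/-- Upper-left block of `Ṙ(v)` vanishes. [folklore] -/
@[simp] theorem drot_inl_inl (v : Fin N → ℂ) (j k : Fin N) : drot v (Sum.inl j) (Sum.inl k) = 0 := rfl
/-- Upper-right block of `Ṙ(v)`. [folklore] -/
@[simp] theorem drot_inl_inr (v : Fin N → ℂ) (j : Fin N) (u : Fin 1) : drot v (Sum.inl j) (Sum.inr u) = v j := rfl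
/-- Lower-left block of `Ṙ(v)`. [folklore] -/
@[simp] theorem drot_inr_inl (v : Fin N → ℂ) (u : Fin 1) (k : Fin N) :
    drot v (Sum.inr u) (Sum.inl k) = -(starRingEnd ℂ) (v k) := rfl
/-- Lower-right entry of `Ṙ(v)` vanishes. [folklore] -/
@[simp] theorem drot_inr_inr (v : Fin N → ℂ) (u u' : Fin 1) : drot v (Sum.inr u) (Sum.inr u') = 0 := rfl

/-- `Ṙ` is additive. [folklore] -/
theorem drot_sub (v v' : Fin N → ℂ) : drot (v - v') = drot v - drot v' := by
  ext i k
  rcases i with j | u <;> rcases k with k | u' <;> simp [sub_eq_add_neg, add_comm]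

/-- `‖Ṙ(v)‖ ≤ 2 N ‖v‖_∞`. [folklore] -/
theorem norm_drot_le (v : Fin N → ℂ) : ‖drot v‖ ≤ 2 * N * ‖v‖ := by
  refine (frob_le_sum _).trans ?_
  rw [Fintype.sum_sum_type]
  simp only [Fintype.sum_sum_type, Fin.sum_univ_one, drot_inl_inl, norm_zero, Finset.sum_const_zero,
    zero_add, drot_inl_inr, drot_inr_inl, norm_neg, Complex.norm_conj, drot_inr_inr, add_zero]
  have h : ∑ j : Fin N, ‖v j‖ ≤ N * ‖v‖ := by
    calc ∑ j : Fin N, ‖v j‖ ≤ ∑ _j : Fin N, ‖v‖ := Finset.sum_le_sum fun j _ => norm_le_pi_norm v j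
      _ = N * ‖v‖ := by simp
  linarith

/-- A component is bounded by `√(nsq)`: `‖v j‖² ≤ |v|²`. [folklore] -/
theorem norm_sq_le_nsq (v : Fin N → ℂ) (j : Fin N) : ‖v j‖ ^ 2 ≤ nsq v :=
  Finset.single_le_sum (f := fun j => ‖v j‖ ^ 2) (fun _ _ => sq_nonneg _) (Finset.mem_univ j)

/-- `‖v j‖ ≤ 1/2` when `|v|² ≤ 1/4`. [folklore] -/
theorem norm_apply_le_half {v : Fin N → ℂ} (hv : nsq v ≤ 1 / 4) (j : Fin N) : ‖v j‖ ≤ 1 / 2 := by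
  have h := (norm_sq_le_nsq v j).trans hv
  nlinarith [norm_nonneg (v j)]

/-- `||v|² - |v'|²| ≤ N (‖v‖_∞ + ‖v'‖_∞) ‖v - v'‖_∞`. [folklore] -/
theorem abs_nsq_sub_nsq_le (v v' : Fin N → ℂ) : |nsq v - nsq v'| ≤ N * (‖v‖ + ‖v'‖) * ‖v - v'‖ := by
  rw [nsq, nsq, ← Finset.sum_sub_distrib]
  refine (Finset.abs_sum_le_sum_abs _ _).trans ?_
  have h : ∀ j : Fin N, |‖v j‖ ^ 2 - ‖v' j‖ ^ 2| ≤ (‖v‖ + ‖v'‖) * ‖v - v'‖ := by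
    intro j
    rw [sq_sub_sq, abs_mul]
    have h1 : |‖v j‖ + ‖v' j‖| ≤ ‖v‖ + ‖v'‖ := by
      rw [abs_of_nonneg (by positivity)]
      exact add_le_add (norm_le_pi_norm v j) (norm_le_pi_norm v' j)
    have h2 : |‖v j‖ - ‖v' j‖| ≤ ‖v - v'‖ :=
      (abs_norm_sub_norm_le (v j) (v' j)).trans (norm_le_pi_norm (v - v') j)
    exact mul_le_mul h1 h2 (abs_nonneg _) (by positivity)
  calc ∑ j, |‖v j‖ ^ 2 - ‖v' j‖ ^ 2| ≤ ∑ _j : Fin N, (‖v‖ + ‖v'‖) * ‖v - v'‖ := Finset.sum_le_sum fun j _ => h j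
    _ = N * (‖v‖ + ‖v'‖) * ‖v - v'‖ := by simp; ring

/-- `c(v) ≥ 1/2` when `|v|² ≤ 1/4`. [folklore] -/
theorem half_le_cw {v : Fin N → ℂ} (hv : nsq v ≤ 1 / 4) : 1 / 2 ≤ cw v := by
  rw [cw, Real.le_sqrt (by norm_num) (by linarith)]
  linarith

/-- `|c(v) - c(v')| ≤ ||v|² - |v'|²|` when `|v|², |v'|² ≤ 1/4`. [folklore] -/
theorem abs_cw_sub_cw_le {v v' : Fin N → ℂ} (hv : nsq v ≤ 1 / 4) (hv' : nsq v' ≤ 1 / 4) :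
    |cw v - cw v'| ≤ |nsq v - nsq v'| := by
  have hc := half_le_cw hv
  have hc' := half_le_cw hv'
  have hprod : (cw v - cw v') * (cw v + cw v') = nsq v' - nsq v := by
    have h1 := cw_sq (by linarith : nsq v ≤ 1)
    have h2 := cw_sq (by linarith : nsq v' ≤ 1)
    nlinarith [h1, h2]
  have hpos : 1 ≤ cw v + cw v' := by linarith
  have h : |cw v - cw v'| * (cw v + cw v') = |nsq v - nsq v'| := by
    rw [← abs_of_pos (by linarith : 0 < cw v + cw v'), ← abs_mul, hprod, abs_sub_comm]
  calc |cw v - cw v'| ≤ |cw v - cw v'| * (cw v + cw v') := le_mul_of_one_le_right (abs_nonneg _) hpos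
    _ = |nsq v - nsq v'| := h

/-- The quadratic entries `v_j v̄_k/(1+c)` of `R`: strict differentiability at `0` with zero
derivative. [folklore] -/
theorem norm_quad_sub_quad_le {v v' : Fin N → ℂ} (hv : nsq v ≤ 1 / 4) (hv' : nsq v' ≤ 1 / 4) (j k : Fin N) :
    ‖v j * (starRingEnd ℂ) (v k) / (1 + cw v) - v' j * (starRingEnd ℂ) (v' k) / (1 + cw v')‖ ≤
      (1 + N / 4) * (‖v‖ + ‖v'‖) * ‖v - v'‖ := by
  set q : ℂ := (1 + (cw v : ℂ))⁻¹ with hq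
  set q' : ℂ := (1 + (cw v' : ℂ))⁻¹ with hq'
  have hc := cw_nonneg v
  have hc' := cw_nonneg v'
  have hqr : q = ((1 + cw v)⁻¹ : ℝ) := by rw [hq]; push_cast; rfl
  have hqr' : q' = ((1 + cw v')⁻¹ : ℝ) := by rw [hq']; push_cast; rfl
  have hqn : ‖q‖ ≤ 1 := by
    rw [hqr, Complex.norm_real, Real.norm_eq_abs, abs_of_pos (by positivity)]
    exact inv_le_one_of_one_le₀ (by linarith)
  have hqq : ‖q - q'‖ ≤ |cw v - cw v'| := by
    rw [hqr, hqr', ← Complex.ofReal_sub, Complex.norm_real, Real.norm_eq_abs,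
      inv_sub_inv (by positivity) (by positivity), abs_div, abs_of_pos (by positivity : (0:ℝ) < (1 + cw v) * (1 + cw v'))]
    rw [div_le_iff₀ (by positivity)]
    rw [show 1 + cw v' - (1 + cw v) = -(cw v - cw v') by ring, abs_neg]
    have h1 : (1 : ℝ) ≤ (1 + cw v) * (1 + cw v') := by nlinarith
    nlinarith [abs_nonneg (cw v - cw v')]
  have e : v j * (starRingEnd ℂ) (v k) / (1 + cw v) - v' j * (starRingEnd ℂ) (v' k) / (1 + cw v') =
      (v j - v' j) * (starRingEnd ℂ) (v k) * q + v' j * ((starRingEnd ℂ) (v k) - (starRingEnd ℂ) (v' k)) * q +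
        v' j * (starRingEnd ℂ) (v' k) * (q - q') := by
    rw [div_eq_mul_inv, div_eq_mul_inv, ← hq, ← hq']; ring
  rw [e]
  have hvj : ‖v k‖ ≤ ‖v‖ := norm_le_pi_norm v k
  have hv'j : ‖v' j‖ ≤ ‖v'‖ := norm_le_pi_norm v' j
  have hd1 : ‖v j - v' j‖ ≤ ‖v - v'‖ := norm_le_pi_norm (v - v') j
  have hd2 : ‖(starRingEnd ℂ) (v k) - (starRingEnd ℂ) (v' k)‖ ≤ ‖v - v'‖ := by
    rw [← map_sub, Complex.norm_conj]; exact norm_le_pi_norm (v - v') k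
  have h4j : ‖v' j‖ ≤ 1 / 2 := norm_apply_le_half hv' j
  have h4k : ‖v' k‖ ≤ 1 / 2 := norm_apply_le_half hv' k
  have hcc : |cw v - cw v'| ≤ N * (‖v‖ + ‖v'‖) * ‖v - v'‖ :=
    (abs_cw_sub_cw_le hv hv').trans (abs_nsq_sub_nsq_le v v')
  calc _ ≤ ‖(v j - v' j) * (starRingEnd ℂ) (v k) * q‖ + ‖v' j * ((starRingEnd ℂ) (v k) - (starRingEnd ℂ) (v' k)) * q‖ +
        ‖v' j * (starRingEnd ℂ) (v' k) * (q - q')‖ := norm_add₃_le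
    _ ≤ ‖v - v'‖ * ‖v‖ * 1 + ‖v'‖ * ‖v - v'‖ * 1 + (1 / 2) * (1 / 2) * (N * (‖v‖ + ‖v'‖) * ‖v - v'‖) := by
        simp only [norm_mul, Complex.norm_conj]
        gcongr
        · exact hqq.trans hcc
    _ ≤ (1 + N / 4) * (‖v‖ + ‖v'‖) * ‖v - v'‖ := by
        have := norm_nonneg v; have := norm_nonneg v'; have := norm_nonneg (v - v')
        nlinarith

/-- **Strict differentiability of `w ↦ R(w)` at `0`**:
`‖R(v) - R(v') - Ṙ(v - v')‖ ≤ (N+1)³ (‖v‖_∞ + ‖v'‖_∞) ‖v - v'‖_∞` for `|v|², |v'|² ≤ 1/4`. [folklore] -/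
theorem norm_rot_sub_rot_sub_drot_le {v v' : Fin N → ℂ} (hv : nsq v ≤ 1 / 4) (hv' : nsq v' ≤ 1 / 4) :
    ‖rot v - rot v' - drot (v - v')‖ ≤ ((N : ℝ) + 1) ^ 3 * (‖v‖ + ‖v'‖) * ‖v - v'‖ := by
  refine (frob_le_sum _).trans ?_
  set S := (‖v‖ + ‖v'‖) * ‖v - v'‖ with hS
  have hS0 : 0 ≤ S := by positivity
  have hquad : ∀ j k : Fin N, ‖(rot v - rot v' - drot (v - v')) (Sum.inl j) (Sum.inl k)‖ ≤ (1 + N / 4) * S := by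
    intro j k
    simp only [Matrix.sub_apply, rot_inl_inl, drot_inl_inl, sub_zero]
    rw [show ((if j = k then (1 : ℂ) else 0) - v j * (starRingEnd ℂ) (v k) / (1 + cw v) -
        ((if j = k then (1 : ℂ) else 0) - v' j * (starRingEnd ℂ) (v' k) / (1 + cw v'))) =
        -(v j * (starRingEnd ℂ) (v k) / (1 + cw v) - v' j * (starRingEnd ℂ) (v' k) / (1 + cw v')) by ring,
      norm_neg, hS, ← mul_assoc]
    exact norm_quad_sub_quad_le hv hv' j k
  have hcc : ‖(rot v - rot v' - drot (v - v')) (Sum.inr 0) (Sum.inr 0)‖ ≤ N * S := by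
    simp only [Matrix.sub_apply, rot_inr_inr, drot_inr_inr, sub_zero, ← Complex.ofReal_sub, Complex.norm_real,
      Real.norm_eq_abs, hS, ← mul_assoc]
    exact (abs_cw_sub_cw_le hv hv').trans (abs_nsq_sub_nsq_le v v')
  have hzero1 : ∀ j : Fin N, ‖(rot v - rot v' - drot (v - v')) (Sum.inl j) (Sum.inr 0)‖ = 0 := by
    intro j; simp
  have hzero2 : ∀ k : Fin N, ‖(rot v - rot v' - drot (v - v')) (Sum.inr 0) (Sum.inl k)‖ = 0 := by
    intro k
    rw [norm_eq_zero]
    simp only [Matrix.sub_apply, rot_inr_inl, drot_inr_inl, Pi.sub_apply, map_sub]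
    ring
  rw [Fintype.sum_sum_type]
  simp only [Fintype.sum_sum_type, Fin.sum_univ_one, hzero1, hzero2, add_zero, Finset.sum_const_zero, zero_add]
  calc ∑ j : Fin N, ∑ k : Fin N, ‖(rot v - rot v' - drot (v - v')) (Sum.inl j) (Sum.inl k)‖ +
        ‖(rot v - rot v' - drot (v - v')) (Sum.inr 0) (Sum.inr 0)‖
      ≤ ∑ _j : Fin N, ∑ _k : Fin N, (1 + N / 4) * S + N * S :=
        add_le_add (Finset.sum_le_sum fun j _ => Finset.sum_le_sum fun k _ => hquad j k) hcc
    _ = ((N : ℝ) * N * (1 + N / 4) + N) * S := by simp; ring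
    _ ≤ ((N : ℝ) + 1) ^ 3 * S := by
        apply mul_le_mul_of_nonneg_right _ hS0
        have hN : (0 : ℝ) ≤ N := Nat.cast_nonneg N
        nlinarith [sq_nonneg (N : ℝ)]
    _ = ((N : ℝ) + 1) ^ 3 * (‖v‖ + ‖v'‖) * ‖v - v'‖ := by rw [hS, mul_assoc]

/-- In particular `‖R(v) - 1 - Ṙ(v)‖ ≤ (N+1)³ ‖v‖²` and so `‖R(v) - 1‖ ≤ ((N+1)³ ‖v‖ + 2N) ‖v‖`. [folklore] -/
theorem norm_rot_sub_one_le {v : Fin N → ℂ} (hv : nsq v ≤ 1 / 4) :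
    ‖rot v - 1‖ ≤ (((N : ℝ) + 1) ^ 3 * ‖v‖ + 2 * N) * ‖v‖ := by
  have h := norm_rot_sub_rot_sub_drot_le hv (v' := 0) (by rw [nsq_zero]; norm_num)
  rw [rot_zero, sub_zero, norm_zero, add_zero] at h
  have h2 := norm_drot_le v
  calc ‖rot v - 1‖ = ‖(rot v - 1 - drot v) + drot v‖ := by rw [sub_add_cancel]
    _ ≤ ‖rot v - 1 - drot v‖ + ‖drot v‖ := norm_add_le _ _
    _ ≤ ((N : ℝ) + 1) ^ 3 * ‖v‖ * ‖v‖ + 2 * N * ‖v‖ := add_le_add h h2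
    _ = (((N : ℝ) + 1) ^ 3 * ‖v‖ + 2 * N) * ‖v‖ := by ring

end Rot

/-! ### The transition map between the fibration coordinates and the Cayley chart -/

section Chart

local notation "𝕄I" => Matrix (Idx N) (Idx N) ℂ
local notation "𝕄F" => Matrix (Fin (N + 1)) (Fin (N + 1)) ℂ

/-- The phase coordinate `t(a) = a₀₀` of `a ∈ ℝ^{(N+1)²}`. [folklore] -/
def tOf (a : 𝔼 (N + 1)) : ℝ := a (0, 0)

/-- The sphere coordinate `w(a)_j = X_{j+1,0}`, `X = skewOf a`. [folklore] -/
def wv (a : 𝔼 (N + 1)) : Fin N → ℂ := fun j => skewOf a j.succ 0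

/-- The fibre coordinate `a' = (a_{j+1,k+1})_{j,k} ∈ ℝ^{N²}`. [folklore] -/
def minor (a : 𝔼 (N + 1)) : 𝔼 N := WithLp.toLp 2 fun p : Fin N × Fin N => a (p.1.succ, p.2.succ)

/-- Coordinates of `minor a`. [folklore] -/
@[simp] theorem minor_apply (a : 𝔼 (N + 1)) (j k : Fin N) : minor a (j, k) = a (j.succ, k.succ) := rfl

/-- `t` is additive. [folklore] -/
theorem tOf_sub (a b : 𝔼 (N + 1)) : tOf (a - b) = tOf a - tOf b := rfl

/-- `w` is additive. [folklore] -/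
theorem wv_sub (a b : 𝔼 (N + 1)) : wv (a - b) = wv a - wv b := by
  funext j; simp [wv, map_sub]

/-- `minor` is additive. [folklore] -/
theorem minor_sub (a b : 𝔼 (N + 1)) : minor (a - b) = minor a - minor b := by
  ext ⟨j, k⟩; simp [minor]

/-- `t(0) = 0`. [folklore] -/
@[simp] theorem tOf_zero : tOf (0 : 𝔼 (N + 1)) = 0 := rfl
/-- `w(0) = 0`. [folklore] -/
@[simp] theorem wv_zero : wv (0 : 𝔼 (N + 1)) = 0 := by funext j; simp [wv]
/-- `minor 0 = 0`. [folklore] -/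
@[simp] theorem minor_zero : minor (0 : 𝔼 (N + 1)) = 0 := by ext ⟨j, k⟩; simp [minor]

/-- A coordinate is bounded by the Euclidean norm. [folklore] -/
theorem abs_apply_le_norm {n : ℕ} (a : 𝔼 n) (p : Fin n × Fin n) : |a p| ≤ ‖a‖ := by
  rw [← Real.norm_eq_abs]
  exact PiLp.norm_apply_le a p

/-- `|t(a)| ≤ ‖a‖`. [folklore] -/
theorem abs_tOf_le (a : 𝔼 (N + 1)) : |tOf a| ≤ ‖a‖ := abs_apply_le_norm a (0, 0)

/-- `‖w(a)_j‖ ≤ ‖a‖`. [folklore] -/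
theorem norm_wv_apply_le (a : 𝔼 (N + 1)) (j : Fin N) : ‖wv a j‖ ≤ ‖a‖ := by
  rw [wv, ← (skewOf (N := N + 1)).norm_map a]
  exact norm_apply_le_frob _ _ _

/-- `‖w(a)‖_∞ ≤ ‖a‖`. [folklore] -/
theorem norm_wv_le (a : 𝔼 (N + 1)) : ‖wv a‖ ≤ ‖a‖ :=
  (pi_norm_le_iff_of_nonneg (norm_nonneg a)).2 fun j => norm_wv_apply_le a j

/-- `|w(a)|² ≤ ‖a‖²`. [folklore] -/
theorem nsq_wv_le (a : 𝔼 (N + 1)) : nsq (wv a) ≤ ‖a‖ ^ 2 := by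
  rw [← (skewOf (N := N + 1)).norm_map a, frob_sq]
  calc nsq (wv a) = ∑ j : Fin N, ‖skewOf a j.succ 0‖ ^ 2 := rfl
    _ ≤ ∑ i : Fin (N + 1), ‖skewOf a i 0‖ ^ 2 := by
        rw [Fin.sum_univ_succ]
        linarith [sq_nonneg ‖skewOf a 0 0‖]
    _ ≤ ∑ i : Fin (N + 1), ∑ k : Fin (N + 1), ‖skewOf a i k‖ ^ 2 :=
        Finset.sum_le_sum fun i _ => Finset.single_le_sum (f := fun k => ‖skewOf a i k‖ ^ 2)
          (fun _ _ => sq_nonneg _) (Finset.mem_univ 0)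

/-- `‖minor a‖ ≤ ‖a‖`. [folklore] -/
theorem norm_minor_le (a : 𝔼 (N + 1)) : ‖minor a‖ ≤ ‖a‖ := by
  have h : ‖minor a‖ ^ 2 ≤ ‖a‖ ^ 2 := by
    rw [EuclideanSpace.norm_eq, EuclideanSpace.norm_eq, Real.sq_sqrt (Finset.sum_nonneg fun _ _ => by positivity),
      Real.sq_sqrt (Finset.sum_nonneg fun _ _ => by positivity)]
    have hinj : Function.Injective (fun p : Fin N × Fin N => ((p.1.succ, p.2.succ) : Fin (N + 1) × Fin (N + 1))) := by
      intro p q h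
      simp only [Prod.mk.injEq, Fin.succ_inj] at h
      exact Prod.ext h.1 h.2
    calc ∑ p : Fin N × Fin N, ‖minor a p‖ ^ 2
        = ∑ q ∈ (Finset.univ : Finset (Fin N × Fin N)).image
            (fun p : Fin N × Fin N => ((p.1.succ, p.2.succ) : Fin (N + 1) × Fin (N + 1))), ‖a q‖ ^ 2 := by
          rw [Finset.sum_image fun p _ q _ h => hinj h]; rfl
      _ ≤ ∑ q, ‖a q‖ ^ 2 := Finset.sum_le_sum_of_subset_of_nonneg (Finset.subset_univ _) fun _ _ _ => by positivity
  exact le_of_sq_le_sq (by simpa using h) (norm_nonneg _) |> fun h' => by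
    have := abs_le_of_sq_le_sq' h (norm_nonneg a)
    exact this.2

/-- The linear part `Ḃ(a) = diag(skewOf a', i t(a))` of the fibre/phase block. [folklore] -/
def dB (a : 𝔼 (N + 1)) : 𝕄I := bd (skewOf (minor a)) (((tOf a : ℝ) : ℂ) * I)

/-- **The coordinate identity**: `Ṙ(w(a)) + Ḃ(a)` is the block form of `skewOf a`; this is why the
transition map has the identity as derivative at `0`. [folklore] -/
theorem drot_add_dB (a : 𝔼 (N + 1)) : drot (wv a) + dB a = ofFin (skewOf a) := by
  ext i k
  rcases i with j | u <;> rcases k with k | u'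
  · simp only [Matrix.add_apply, drot_inl_inl, dB, bd_inl_inl, zero_add, ofFin_apply, eIdx_inl, skewOf_apply,
      minor_apply]
  · obtain rfl : u' = 0 := Subsingleton.elim _ _
    simp only [Matrix.add_apply, drot_inl_inr, dB, bd_inl_inr, add_zero, ofFin_apply, eIdx_inl, eIdx_inr, wv]
  · obtain rfl : u = 0 := Subsingleton.elim _ _
    simp only [Matrix.add_apply, drot_inr_inl, dB, bd_inr_inl, add_zero, ofFin_apply, eIdx_inl, eIdx_inr, wv,
      skewOf_apply]
    apply Complex.ext <;> simp <;> ring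
  · obtain rfl : u = 0 := Subsingleton.elim _ _
    obtain rfl : u' = 0 := Subsingleton.elim _ _
    simp only [Matrix.add_apply, drot_inr_inr, dB, bd_inr_inr, zero_add, ofFin_apply, eIdx_inr, skewOf_apply, tOf]
    apply Complex.ext <;> simp

/-- The fibre/phase block `B(a) = diag(cay(skewOf a'), e^{i t(a)})`. [folklore] -/
def Bm (a : 𝔼 (N + 1)) : 𝕄I := bd (cay (skewOf (minor a))) (Complex.exp (tOf a * I))

/-- The parametrisation in block form, `P(a) = R(w(a)) B(a)`. [folklore] -/
def Pm (a : 𝔼 (N + 1)) : 𝕄I := rot (wv a) * Bm a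

/-- The parametrisation as a matrix of `U(N+1)`: `Ψ(a) = toFin P(a)`. [folklore] -/
def Psi (a : 𝔼 (N + 1)) : 𝕄F := toFin (Pm a)

/-- `Ψ(a)` is the matrix of `mk(t(a), w(a), chart a')` for `‖a‖ ≤ 1`. [folklore] -/
theorem coe_mk_eq_Psi {a : 𝔼 (N + 1)} (ha : ‖a‖ ≤ 1) :
    ((mk (tOf a) (wv a) (chart (minor a)) : 𝔾 (N + 1)) : 𝕄F) = Psi a := by
  have hw : nsq (wv a) ≤ 1 := (nsq_wv_le a).trans (by nlinarith [norm_nonneg a])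
  rw [mk, dif_pos hw]
  rfl

/-- `Ψ(a)` is unitary for `‖a‖ ≤ 1`. [folklore] -/
theorem Psi_mem {a : 𝔼 (N + 1)} (ha : ‖a‖ ≤ 1) : Psi a ∈ Matrix.unitaryGroup (Fin (N + 1)) ℂ := by
  rw [← coe_mk_eq_Psi ha]; exact SetLike.coe_mem _

/-- `Ψ(0) = 1`. [folklore] -/
@[simp] theorem Psi_zero : Psi (0 : 𝔼 (N + 1)) = 1 := by
  simp [Psi, Pm, Bm, wv_zero, rot_zero]

/-- `bd` is additive. [folklore] -/
theorem bd_sub (W W' : Matrix (Fin N) (Fin N) ℂ) (u u' : ℂ) : bd W u - bd W' u' = bd (W - W') (u - u') := by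
  ext i k
  rcases i with j | i <;> rcases k with k | i' <;> simp [bd_inl_inl, bd_inl_inr, bd_inr_inl, bd_inr_inr]

/-- `‖diag(W, u)‖ ≤ ‖W‖ + |u|`. [folklore] -/
theorem norm_bd_le (W : Matrix (Fin N) (Fin N) ℂ) (u : ℂ) : ‖bd W u‖ ≤ ‖W‖ + ‖u‖ := by
  have h1 : ‖bd W 0‖ = ‖W‖ := by
    have h : ‖bd W 0‖ ^ 2 = ‖W‖ ^ 2 := by
      rw [frob_sq, frob_sq, Fintype.sum_sum_type]
      simp [Fintype.sum_sum_type]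
    exact le_antisymm (le_of_sq_le_sq (h.le.trans (le_refl _)) (norm_nonneg _))
      (le_of_sq_le_sq (h.ge.trans (le_refl _)) (norm_nonneg _))
  have h2 : ‖bd (0 : Matrix (Fin N) (Fin N) ℂ) u‖ = ‖u‖ := by
    have h : ‖bd (0 : Matrix (Fin N) (Fin N) ℂ) u‖ ^ 2 = ‖u‖ ^ 2 := by
      rw [frob_sq, Fintype.sum_sum_type]
      simp [Fintype.sum_sum_type]
    exact le_antisymm (le_of_sq_le_sq (h.le.trans (le_refl _)) (norm_nonneg _))
      (le_of_sq_le_sq (h.ge.trans (le_refl _)) (norm_nonneg _))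
  have e : bd W u = bd W 0 + bd 0 u := by
    ext i k
    rcases i with j | i <;> rcases k with k | i' <;> simp
  rw [e]
  exact (norm_add_le _ _).trans (by rw [h1, h2])

/-- `toFin` is additive. [folklore] -/
theorem toFin_sub (M M' : 𝕄I) : toFin (M - M') = toFin M - toFin M' := rfl

/-- `toFin` is additive. [folklore] -/
theorem toFin_add (M M' : 𝕄I) : toFin (M + M') = toFin M + toFin M' := rfl

/-- `toFin` is an isometry for the Frobenius norms. [folklore] -/
theorem norm_toFin (M : 𝕄I) : ‖toFin M‖ = ‖M‖ := frobenius_norm_toFin M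

/-- `‖B(a) - 1‖ ≤ 2 ‖a‖` for `‖a‖ ≤ 1`. [folklore] -/
theorem norm_Bm_sub_one_le (a : 𝔼 (N + 1)) : ‖Bm a - 1‖ ≤ 2 * ‖a‖ := by
  rw [Bm, ← bd_one_one, bd_sub]
  refine (norm_bd_le _ _).trans ?_
  have h1 : ‖cay (skewOf (minor a)) - 1‖ ≤ ‖a‖ :=
    (norm_chart_sub_one_le (minor a)).trans (norm_minor_le a)
  have h2 : ‖Complex.exp (tOf a * I) - 1‖ ≤ ‖a‖ := by
    have h := Real.norm_exp_I_mul_ofReal_sub_one_le (x := tOf a)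
    rw [mul_comm] at h
    exact h.trans ((Real.norm_eq_abs _).le.trans (abs_tOf_le a))
  linarith

/-- `‖Ḃ(c)‖ ≤ 2 ‖c‖`. [folklore] -/
theorem norm_dB_le (c : 𝔼 (N + 1)) : ‖dB c‖ ≤ 2 * ‖c‖ := by
  refine (norm_bd_le _ _).trans ?_
  rw [LinearIsometry.norm_map, norm_mul, Complex.norm_I, mul_one, Complex.norm_real, Real.norm_eq_abs]
  linarith [norm_minor_le c, abs_tOf_le c]

/-- `dB` is additive. [folklore] -/
theorem dB_sub (a b : 𝔼 (N + 1)) : dB (a - b) = dB a - dB b := by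
  rw [dB, dB, dB, bd_sub, minor_sub, map_sub, tOf_sub]
  push_cast
  rw [sub_mul]

/-- **Strict differentiability of the fibre/phase block**: `‖B(a) - B(b) - Ḃ(a - b)‖ ≤ 3 (‖a‖ + ‖b‖) ‖a - b‖`
for `‖a‖, ‖b‖ ≤ 1/2`. [folklore] -/
theorem norm_Bm_sub_Bm_sub_le {a b : 𝔼 (N + 1)} (ha : ‖a‖ ≤ 1 / 2) (hb : ‖b‖ ≤ 1 / 2) :
    ‖Bm a - Bm b - dB (a - b)‖ ≤ 3 * (‖a‖ + ‖b‖) * ‖a - b‖ := by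
  rw [Bm, Bm, bd_sub, dB_sub, dB, dB, bd_sub, bd_sub]
  refine (norm_bd_le _ _).trans ?_
  have hXa : ‖skewOf (minor a)‖ ≤ ‖a‖ := by rw [LinearIsometry.norm_map]; exact norm_minor_le a
  have hXb : ‖skewOf (minor b)‖ ≤ ‖b‖ := by rw [LinearIsometry.norm_map]; exact norm_minor_le b
  have h1 : ‖cay (skewOf (minor a)) - cay (skewOf (minor b)) - (skewOf (minor a) - skewOf (minor b))‖ ≤
      (‖a‖ + ‖b‖) * ‖a - b‖ := by
    refine (norm_cay_sub_cay_sub_le (conjTranspose_skewOf _) (conjTranspose_skewOf _) (by linarith)).trans ?_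
    have e : skewOf (minor a) - skewOf (minor b) = skewOf (minor (a - b)) := by rw [minor_sub, map_sub]
    rw [e, LinearIsometry.norm_map (skewOf (N := N)) (minor (a - b))]
    have h3 := norm_minor_le (a - b)
    have h4 : 0 ≤ ‖skewOf (minor a)‖ + ‖skewOf (minor b)‖ := by positivity
    exact mul_le_mul (add_le_add hXa hXb) h3 (norm_nonneg _) (by positivity)
  have hta : |tOf a| ≤ 1 / 2 := (abs_tOf_le a).trans ha
  have htb : |tOf b| ≤ 1 / 2 := (abs_tOf_le b).trans hb
  have h2 : ‖Complex.exp (tOf a * I) - Complex.exp (tOf b * I) - (((tOf a : ℝ) : ℂ) * I - ((tOf b : ℝ) : ℂ) * I)‖ ≤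
      2 * (‖a‖ + ‖b‖) * ‖a - b‖ := by
    rw [← sub_mul, ← Complex.ofReal_sub]
    refine (norm_exp_sub_exp_sub_le hta htb).trans ?_
    rw [← tOf_sub]
    have h3 : |tOf a| + |tOf b| ≤ ‖a‖ + ‖b‖ := add_le_add (abs_tOf_le a) (abs_tOf_le b)
    have h4 := mul_le_mul h3 (abs_tOf_le (a - b)) (abs_nonneg _) (by positivity)
    linarith
  linarith

/-- The product-rule decomposition of the second-order remainder of `P = R B`. [folklore] -/
theorem product_remainder (Ra Rb Ba Bb D E : 𝕄I) :
    Ra * Ba - Rb * Bb - (D + E) =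
      (Ra - Rb - D) * (Ba - 1) + (Ra - Rb - D) + D * (Ba - 1) + (Rb - 1) * (Ba - Bb) + (Ba - Bb - E) := by
  noncomm_ring

/-- The norm estimate behind the product rule, in abstract form. [folklore] -/
theorem remainder_norm_le (Ra Rb Ba Bb D E : 𝕄I) {K na nb d : ℝ} (hK : 1 ≤ K) (hN : (N : ℝ) ≤ K)
    (h0a : 0 ≤ na) (h0b : 0 ≤ nb) (h0d : 0 ≤ d) (hab : na + nb ≤ 1)
    (p1 : ‖Ra - Rb - D‖ ≤ K * ((na + nb) * d)) (p2 : ‖Ba - 1‖ ≤ 2 * na) (p2' : ‖Ba - 1‖ ≤ 1)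
    (p3 : ‖D‖ ≤ 2 * N * d) (p4 : ‖Rb - 1‖ ≤ (K * nb + 2 * N) * nb) (p5 : ‖Ba - Bb - E‖ ≤ 3 * ((na + nb) * d))
    (p6 : ‖Ba - Bb‖ ≤ 5 * d) :
    ‖(Ra - Rb - D) * (Ba - 1) + (Ra - Rb - D) + D * (Ba - 1) + (Rb - 1) * (Ba - Bb) + (Ba - Bb - E)‖ ≤
      40 * K * (na + nb) * d := by
  have hN0 : (0 : ℝ) ≤ N := Nat.cast_nonneg N
  have hS0 : 0 ≤ (na + nb) * d := by positivity
  have n1 : ‖(Ra - Rb - D) * (Ba - 1)‖ ≤ K * ((na + nb) * d) * 1 :=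
    (Matrix.frobenius_norm_mul _ _).trans (mul_le_mul p1 p2' (norm_nonneg _) (by positivity))
  have n3 : ‖D * (Ba - 1)‖ ≤ 2 * N * d * (2 * na) :=
    (Matrix.frobenius_norm_mul _ _).trans (mul_le_mul p3 p2 (norm_nonneg _) (by positivity))
  have n4 : ‖(Rb - 1) * (Ba - Bb)‖ ≤ (K * nb + 2 * N) * nb * (5 * d) :=
    (Matrix.frobenius_norm_mul _ _).trans (mul_le_mul p4 p6 (norm_nonneg _) (by positivity))
  have e1 : 2 * N * d * (2 * na) ≤ 4 * K * ((na + nb) * d) := by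
    have h1 : (N : ℝ) * na ≤ K * (na + nb) := mul_le_mul hN (by linarith) h0a (by linarith)
    nlinarith
  have e2 : (K * nb + 2 * N) * nb * (5 * d) ≤ 15 * K * ((na + nb) * d) := by
    have h1 : K * nb + 2 * N ≤ 3 * K := by nlinarith
    have h2 : (K * nb + 2 * N) * nb ≤ 3 * K * (na + nb) := by nlinarith
    nlinarith
  calc ‖(Ra - Rb - D) * (Ba - 1) + (Ra - Rb - D) + D * (Ba - 1) + (Rb - 1) * (Ba - Bb) + (Ba - Bb - E)‖
      ≤ ‖(Ra - Rb - D) * (Ba - 1)‖ + ‖Ra - Rb - D‖ + ‖D * (Ba - 1)‖ + ‖(Rb - 1) * (Ba - Bb)‖ + ‖Ba - Bb - E‖ := by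
        refine (norm_add_le _ _).trans (add_le_add ?_ le_rfl)
        refine (norm_add_le _ _).trans (add_le_add ?_ le_rfl)
        refine (norm_add_le _ _).trans (add_le_add ?_ le_rfl)
        exact norm_add_le _ _
    _ ≤ K * ((na + nb) * d) * 1 + K * ((na + nb) * d) + 4 * K * ((na + nb) * d) + 15 * K * ((na + nb) * d) +
          3 * ((na + nb) * d) := by linarith
    _ ≤ 40 * K * (na + nb) * d := by nlinarith

/-- **Strict differentiability of the block parametrisation at `0`**:
`‖P(a) - P(b) - (Ṙ(w(a) - w(b)) + Ḃ(a) - Ḃ(b))‖ ≤ 40 (N+1)³ (‖a‖ + ‖b‖) ‖a - b‖` for `‖a‖, ‖b‖ ≤ 1/2`. [folklore] -/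
theorem norm_Pm_sub_Pm_sub_le {a b : 𝔼 (N + 1)} (ha : ‖a‖ ≤ 1 / 2) (hb : ‖b‖ ≤ 1 / 2) :
    ‖Pm a - Pm b - (drot (wv a - wv b) + (dB a - dB b))‖ ≤ 40 * ((N : ℝ) + 1) ^ 3 * (‖a‖ + ‖b‖) * ‖a - b‖ := by
  rw [Pm, Pm, product_remainder]
  have hwa : nsq (wv a) ≤ 1 / 4 := (nsq_wv_le a).trans (by nlinarith [norm_nonneg a])
  have hwb : nsq (wv b) ≤ 1 / 4 := (nsq_wv_le b).trans (by nlinarith [norm_nonneg b])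
  have hN0 : (0 : ℝ) ≤ N := Nat.cast_nonneg N
  have hK1 : (1 : ℝ) ≤ ((N : ℝ) + 1) ^ 3 := one_le_pow₀ (by linarith)
  have hNK : (N : ℝ) ≤ ((N : ℝ) + 1) ^ 3 := by nlinarith [sq_nonneg (N : ℝ)]
  have p1 : ‖rot (wv a) - rot (wv b) - drot (wv a - wv b)‖ ≤ ((N : ℝ) + 1) ^ 3 * ((‖a‖ + ‖b‖) * ‖a - b‖) := by
    refine (norm_rot_sub_rot_sub_drot_le hwa hwb).trans ?_
    rw [mul_assoc]
    refine mul_le_mul_of_nonneg_left ?_ (by positivity)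
    rw [← wv_sub]
    exact mul_le_mul (add_le_add (norm_wv_le a) (norm_wv_le b)) (norm_wv_le _) (norm_nonneg _) (by positivity)
  have p2 : ‖Bm a - 1‖ ≤ 2 * ‖a‖ := norm_Bm_sub_one_le a
  have p2' : ‖Bm a - 1‖ ≤ 1 := by linarith
  have p3 : ‖drot (wv a - wv b)‖ ≤ 2 * N * ‖a - b‖ := by
    refine (norm_drot_le _).trans ?_
    rw [← wv_sub]
    exact mul_le_mul_of_nonneg_left (norm_wv_le _) (by positivity)
  have p4 : ‖rot (wv b) - 1‖ ≤ (((N : ℝ) + 1) ^ 3 * ‖b‖ + 2 * N) * ‖b‖ := by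
    refine (norm_rot_sub_one_le hwb).trans ?_
    have h1 := norm_wv_le b
    have h2 : 0 ≤ ‖wv b‖ := norm_nonneg _
    have h3 : ((N : ℝ) + 1) ^ 3 * ‖wv b‖ + 2 * N ≤ ((N : ℝ) + 1) ^ 3 * ‖b‖ + 2 * N := by nlinarith
    calc (((N : ℝ) + 1) ^ 3 * ‖wv b‖ + 2 * N) * ‖wv b‖ ≤ (((N : ℝ) + 1) ^ 3 * ‖b‖ + 2 * N) * ‖wv b‖ :=
          mul_le_mul_of_nonneg_right h3 h2
      _ ≤ (((N : ℝ) + 1) ^ 3 * ‖b‖ + 2 * N) * ‖b‖ := mul_le_mul_of_nonneg_left h1 (by positivity)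
  have p5 : ‖Bm a - Bm b - (dB a - dB b)‖ ≤ 3 * ((‖a‖ + ‖b‖) * ‖a - b‖) := by
    rw [← dB_sub, ← mul_assoc]; exact norm_Bm_sub_Bm_sub_le ha hb
  have p6 : ‖Bm a - Bm b‖ ≤ 5 * ‖a - b‖ := by
    have h1 : ‖dB a - dB b‖ ≤ 2 * ‖a - b‖ := by rw [← dB_sub]; exact norm_dB_le _
    calc ‖Bm a - Bm b‖ = ‖(Bm a - Bm b - (dB a - dB b)) + (dB a - dB b)‖ := by rw [sub_add_cancel]
      _ ≤ ‖Bm a - Bm b - (dB a - dB b)‖ + ‖dB a - dB b‖ := norm_add_le _ _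
      _ ≤ 3 * ((‖a‖ + ‖b‖) * ‖a - b‖) + 2 * ‖a - b‖ := add_le_add p5 h1
      _ ≤ 5 * ‖a - b‖ := by nlinarith [norm_nonneg (a - b), norm_nonneg a, norm_nonneg b]
  have h := remainder_norm_le (rot (wv a)) (rot (wv b)) (Bm a) (Bm b) (drot (wv a - wv b)) (dB a - dB b)
    hK1 hNK (norm_nonneg a) (norm_nonneg b) (norm_nonneg (a - b)) (by linarith) p1 p2 p2' p3 p4 p5 p6
  linarith

/-- **Strict differentiability of the parametrisation at `0` with derivative `skewOf`**:
`‖Ψ(a) - Ψ(b) - skewOf(a - b)‖ ≤ 40 (N+1)³ (‖a‖ + ‖b‖) ‖a - b‖` for `‖a‖, ‖b‖ ≤ 1/2`. [folklore] -/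
theorem norm_Psi_sub_Psi_sub_le {a b : 𝔼 (N + 1)} (ha : ‖a‖ ≤ 1 / 2) (hb : ‖b‖ ≤ 1 / 2) :
    ‖Psi a - Psi b - skewOf (a - b)‖ ≤ 40 * ((N : ℝ) + 1) ^ 3 * (‖a‖ + ‖b‖) * ‖a - b‖ := by
  have hkey : skewOf (a - b) = toFin (drot (wv a - wv b) + (dB a - dB b)) := by
    rw [← wv_sub, ← dB_sub, drot_add_dB, toFin_ofFin]
  rw [hkey, Psi, Psi, ← toFin_sub, ← toFin_sub, norm_toFin]
  exact norm_Pm_sub_Pm_sub_le ha hb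

/-- The constant `K_N = (N+1)³`. [folklore] -/
def KN (N : ℕ) : ℝ := ((N : ℝ) + 1) ^ 3

/-- `1 ≤ K_N`. [folklore] -/
theorem one_le_KN (N : ℕ) : 1 ≤ KN N := one_le_pow₀ (by rw [le_add_iff_nonneg_left]; exact Nat.cast_nonneg N)

/-- `0 < K_N`. [folklore] -/
theorem KN_pos (N : ℕ) : 0 < KN N := lt_of_lt_of_le one_pos (one_le_KN N)

/-- The radius `r_N = 1/(80 K_N)` below which all second-order estimates are in force. [folklore] -/
def rN (N : ℕ) : ℝ := 1 / (80 * KN N)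

/-- `0 < r_N`. [folklore] -/
theorem rN_pos (N : ℕ) : 0 < rN N := by unfold rN; exact div_pos one_pos (by linarith [one_le_KN N])

/-- `r_N ≤ 1/2`. [folklore] -/
theorem rN_le_half (N : ℕ) : rN N ≤ 1 / 2 := by
  unfold rN; rw [div_le_div_iff₀ (by linarith [one_le_KN N]) (by norm_num)]; linarith [one_le_KN N]

/-- `‖Ψ(a) - 1‖ ≤ 2 ‖a‖` for `‖a‖ ≤ r_N`. [folklore] -/
theorem norm_Psi_sub_one_le {a : 𝔼 (N + 1)} (ha : ‖a‖ ≤ rN N) : ‖Psi a - 1‖ ≤ 2 * ‖a‖ := by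
  have ha2 : ‖a‖ ≤ 1 / 2 := ha.trans (rN_le_half N)
  have h := norm_Psi_sub_Psi_sub_le ha2 (b := 0) (by rw [norm_zero]; norm_num)
  rw [Psi_zero, sub_zero, norm_zero, add_zero] at h
  have hK := one_le_KN N
  have hr : 40 * KN N * ‖a‖ ≤ 1 := by
    have := mul_le_mul_of_nonneg_left ha (by linarith : (0 : ℝ) ≤ 40 * KN N)
    rw [rN, mul_one_div, div_eq_mul_inv] at this
    calc 40 * KN N * ‖a‖ ≤ 40 * KN N * (80 * KN N)⁻¹ := this
      _ ≤ 1 := by rw [← div_eq_mul_inv, div_le_one (by linarith)]; linarith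
  calc ‖Psi a - 1‖ = ‖(Psi a - 1 - skewOf a) + skewOf a‖ := by rw [sub_add_cancel]
    _ ≤ ‖Psi a - 1 - skewOf a‖ + ‖skewOf a‖ := norm_add_le _ _
    _ ≤ 40 * ((N : ℝ) + 1) ^ 3 * ‖a‖ * ‖a‖ + ‖a‖ := add_le_add h (le_of_eq (LinearIsometry.norm_map _ _))
    _ ≤ 2 * ‖a‖ := by rw [← KN] at *; nlinarith [norm_nonneg a]

/-- `Ψ` is `2`-Lipschitz on the ball of radius `r_N`. [folklore] -/
theorem norm_Psi_sub_Psi_le {a b : 𝔼 (N + 1)} (ha : ‖a‖ ≤ rN N) (hb : ‖b‖ ≤ rN N) :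
    ‖Psi a - Psi b‖ ≤ 2 * ‖a - b‖ := by
  have ha2 : ‖a‖ ≤ 1 / 2 := ha.trans (rN_le_half N)
  have hb2 : ‖b‖ ≤ 1 / 2 := hb.trans (rN_le_half N)
  have h := norm_Psi_sub_Psi_sub_le ha2 hb2
  have hK := one_le_KN N
  have hr : 40 * KN N * (‖a‖ + ‖b‖) ≤ 1 := by
    have hab : ‖a‖ + ‖b‖ ≤ 2 * rN N := by linarith
    have := mul_le_mul_of_nonneg_left hab (by linarith : (0 : ℝ) ≤ 40 * KN N)
    refine this.trans ?_
    rw [rN, show 40 * KN N * (2 * (1 / (80 * KN N))) = (80 * KN N) / (80 * KN N) by ring,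
      div_self (by linarith)]
  calc ‖Psi a - Psi b‖ = ‖(Psi a - Psi b - skewOf (a - b)) + skewOf (a - b)‖ := by rw [sub_add_cancel]
    _ ≤ ‖Psi a - Psi b - skewOf (a - b)‖ + ‖skewOf (a - b)‖ := norm_add_le _ _
    _ ≤ 40 * ((N : ℝ) + 1) ^ 3 * (‖a‖ + ‖b‖) * ‖a - b‖ + ‖a - b‖ :=
        add_le_add h (le_of_eq (LinearIsometry.norm_map _ _))
    _ ≤ 2 * ‖a - b‖ := by rw [← KN] at *; nlinarith [norm_nonneg (a - b)]

/-- **The transition map** `Φ = ichart ∘ mk ∘ (t, w, chart ∘ minor)` between the fibration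
coordinates and the Cayley chart of `U(N+1)`. [folklore] -/
def Phi (a : 𝔼 (N + 1)) : 𝔼 (N + 1) := ichart (mk (tOf a) (wv a) (chart (minor a)))

/-- `Φ(a) = unskew (icay Ψ(a))` for `‖a‖ ≤ 1`. [folklore] -/
theorem Phi_eq {a : 𝔼 (N + 1)} (ha : ‖a‖ ≤ 1) : Phi a = unskew (icay (Psi a)) := by
  rw [Phi, ichart, coe_mk_eq_Psi ha]

/-- `Φ(0) = 0`. [folklore] -/
@[simp] theorem Phi_zero : Phi (0 : 𝔼 (N + 1)) = 0 := by
  rw [Phi_eq (by rw [norm_zero]; norm_num), Psi_zero, icay_one, unskew_zero]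

/-- The chart value of `Φ(a)` is the parametrised unitary, for `‖a‖ ≤ r_N`. [folklore] -/
theorem chart_Phi {a : 𝔼 (N + 1)} (ha : ‖a‖ ≤ rN N) :
    chart (Phi a) = mk (tOf a) (wv a) (chart (minor a)) := by
  have ha1 : ‖a‖ ≤ 1 := ha.trans ((rN_le_half N).trans (by norm_num))
  refine chart_ichart ?_
  rw [coe_mk_eq_Psi ha1]
  have := norm_Psi_sub_one_le ha
  linarith [rN_le_half N]

/-- `unskew` is additive. [folklore] -/
theorem unskew_sub' {n : ℕ} (X Y : Matrix (Fin n) (Fin n) ℂ) : unskew (X - Y) = unskew X - unskew Y := by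
  ext p
  simp only [unskew_apply, Matrix.sub_apply, Complex.sub_re, Complex.sub_im, PiLp.sub_apply]
  ring

/-- **Strict differentiability of the transition map at `0` with derivative the identity**:
`‖Φ(a) - Φ(b) - (a - b)‖ ≤ 48 K_N (‖a‖ + ‖b‖) ‖a - b‖` for `‖a‖, ‖b‖ ≤ r_N`. [folklore] -/
theorem norm_Phi_sub_Phi_sub_le {a b : 𝔼 (N + 1)} (ha : ‖a‖ ≤ rN N) (hb : ‖b‖ ≤ rN N) :
    ‖Phi a - Phi b - (a - b)‖ ≤ 48 * KN N * (‖a‖ + ‖b‖) * ‖a - b‖ := by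
  have hr2 := rN_le_half N
  have ha2 : ‖a‖ ≤ 1 / 2 := ha.trans hr2
  have hb2 : ‖b‖ ≤ 1 / 2 := hb.trans hr2
  have ha1 : ‖a‖ ≤ 1 := by linarith
  have hb1 : ‖b‖ ≤ 1 := by linarith
  have hΨa := norm_Psi_sub_one_le ha
  have hΨb := norm_Psi_sub_one_le hb
  have hΨa1 : ‖Psi a - 1‖ ≤ 1 := by linarith
  have hΨb1 : ‖Psi b - 1‖ ≤ 1 := by linarith
  -- skew-Hermitian pieces
  have hsa : (icay (Psi a))ᴴ = -icay (Psi a) := conjTranspose_icay (Psi_mem ha1) (by linarith)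
  have hsb : (icay (Psi b))ᴴ = -icay (Psi b) := conjTranspose_icay (Psi_mem hb1) (by linarith)
  set Z := icay (Psi a) - icay (Psi b) - skewOf (a - b) with hZ
  have hZs : Zᴴ = -Z := by
    rw [hZ, conjTranspose_sub, conjTranspose_sub, hsa, hsb, conjTranspose_skewOf]; abel
  have e : Phi a - Phi b - (a - b) = unskew Z := by
    rw [Phi_eq ha1, Phi_eq hb1, hZ, unskew_sub', unskew_sub', unskew_skewOf]
  have hnorm : ‖unskew Z‖ = ‖Z‖ := by
    have h := norm_unskew_sub_unskew hZs (show (0 : Matrix (Fin (N + 1)) (Fin (N + 1)) ℂ)ᴴ = -0 by simp)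
    rwa [unskew_zero, sub_zero, sub_zero] at h
  rw [e, hnorm, hZ]
  have h1 := norm_icay_sub_icay_sub_le hΨa1 hΨb1
  have h2 := norm_Psi_sub_Psi_sub_le ha2 hb2
  have h3 := norm_Psi_sub_Psi_le ha hb
  calc ‖icay (Psi a) - icay (Psi b) - skewOf (a - b)‖
      = ‖(icay (Psi a) - icay (Psi b) - (Psi a - Psi b)) + (Psi a - Psi b - skewOf (a - b))‖ := by
        congr 1; abel
    _ ≤ ‖icay (Psi a) - icay (Psi b) - (Psi a - Psi b)‖ + ‖Psi a - Psi b - skewOf (a - b)‖ := norm_add_le _ _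
    _ ≤ 2 * (‖Psi a - 1‖ + ‖Psi b - 1‖) * ‖Psi a - Psi b‖ + 40 * ((N : ℝ) + 1) ^ 3 * (‖a‖ + ‖b‖) * ‖a - b‖ :=
        add_le_add h1 h2
    _ ≤ 2 * (2 * ‖a‖ + 2 * ‖b‖) * (2 * ‖a - b‖) + 40 * KN N * (‖a‖ + ‖b‖) * ‖a - b‖ := by
        rw [← KN]
        have h4 : 2 * (‖Psi a - 1‖ + ‖Psi b - 1‖) ≤ 2 * (2 * ‖a‖ + 2 * ‖b‖) := by linarith
        have h5 := mul_le_mul h4 h3 (norm_nonneg _) (by positivity)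
        linarith
    _ ≤ 48 * KN N * (‖a‖ + ‖b‖) * ‖a - b‖ := by
        have hK := one_le_KN N
        have hS : 0 ≤ (‖a‖ + ‖b‖) * ‖a - b‖ := by positivity
        have e1 : 2 * (2 * ‖a‖ + 2 * ‖b‖) * (2 * ‖a - b‖) = 8 * ((‖a‖ + ‖b‖) * ‖a - b‖) := by ring
        have e2 : 8 * ((‖a‖ + ‖b‖) * ‖a - b‖) ≤ 8 * KN N * ((‖a‖ + ‖b‖) * ‖a - b‖) := by nlinarith
        nlinarith

/-- **The transition map approximates the identity**: for every `c > 0` there is `r > 0` with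
`ApproximatesLinearOn Φ id (closedBall 0 r) c` (this is the hypothesis of Mathlib's volume-distortion
lemmas `addHaar_image_le_mul_of_det_lt` / `mul_le_addHaar_image_of_lt_det`). [folklore] -/
theorem approximatesLinearOn_Phi {c : ℝ≥0} (hc : 0 < c) :
    ∃ r : ℝ, 0 < r ∧ r ≤ rN N ∧
      ApproximatesLinearOn Phi (ContinuousLinearMap.id ℝ (𝔼 (N + 1))) (Metric.closedBall 0 r) c := by
  have hK := KN_pos N
  refine ⟨min (rN N) ((c : ℝ) / (96 * KN N)), lt_min (rN_pos N) (div_pos (by exact_mod_cast hc) (by linarith)),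
    min_le_left _ _, ?_⟩
  intro a ha b hb
  rw [Metric.mem_closedBall, dist_zero_right] at ha hb
  have ha' : ‖a‖ ≤ rN N := ha.trans (min_le_left _ _)
  have hb' : ‖b‖ ≤ rN N := hb.trans (min_le_left _ _)
  have hac : ‖a‖ ≤ (c : ℝ) / (96 * KN N) := ha.trans (min_le_right _ _)
  have hbc : ‖b‖ ≤ (c : ℝ) / (96 * KN N) := hb.trans (min_le_right _ _)
  simp only [ContinuousLinearMap.id_apply]
  refine (norm_Phi_sub_Phi_sub_le ha' hb').trans ?_
  have hsum : 48 * KN N * (‖a‖ + ‖b‖) ≤ c := by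
    have h := add_le_add hac hbc
    rw [← two_mul] at h
    have h2 := mul_le_mul_of_nonneg_left h (by linarith : (0 : ℝ) ≤ 48 * KN N)
    refine h2.trans (le_of_eq ?_)
    field_simp
    ring
  exact mul_le_mul_of_nonneg_right hsum (norm_nonneg _)

end Chart

end UnitaryColumn

end Literature.MathematicalPhysics.QuantumFieldTheory
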